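import Literature.Analysis.FluidPDE.RusinSverakCompactnessProofs
import Literature.Analysis.FluidPDE.KatoViscosityScaling
import Literature.Analysis.FluidPDE.KatoSymmetryCovariance
import HarnessLib

/-!
# Rusin–Šverák's minimal blow-up data from the weak-limit blow-up fact

Analysis/FluidPDE support file, definitions-free. `RusinSverakCompactnessProofs.lean` reduces
the named fact `Literature.Analysis.FluidPDE.rusin_sverak_minimal_data_compact` (Rusin–Šverák, J. Funct. Anal. 260
(2011) = arXiv:0911.0500, Cor. 4.3 p. 8, *second* clause: compactness of the set `M` of
`Ḣ^{1/2}`-minimal blow-up data modulo scalings and translations) to the single PDE fact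
`Literature.Analysis.FluidPDE.rusin_sverak_weak_limit_blowup` (the data-level content of the printed proof of
Cor. 4.3: after normalising the first singularity to `(0, 1)`, weak `Ḣ^{1/2}`-limits of blow-up
data blow up; Cor. 4.2 + Prop. 4.1). This file draws the remaining printed consequences from
the same fact, following the same six-line proof (p. 8):

* `NS.rusin_sverak_minimal_blowup_of_weak_limit_blowup`: the *first* clause of Cor. 4.3, "the
  set `M` is non-empty" — the tree's named fact `Literature.Analysis.FluidPDE.rusin_sverak_minimal_blowup`
  (`MildSolutions.lean`, **ns.S14**) — follows as printed: take blow-up data `u₀^k` with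
  `‖u₀^k‖_{Ḣ^{1/2}} → ρ_max` (they exist by the definition of `ρ_max` as a supremum,
  `NS.exists_blowup_datum_enorm_lt`), normalise, pass to a weak limit `v₀`; it blows up (the
  fact), so `‖v₀‖ ≥ ρ_max` by the definition of `ρ_max`, and `‖v₀‖ ≤ lim ‖u₀^k‖ = ρ_max` by weak
  lower semicontinuity (`norm_le_of_tendsto_inner_of_norm_le`).
* `NS.rusin_sverak_minimal_data_subseq_limit_of_weak_limit_blowup`: the compactness clause in
  the strong form in which it is stated in §1 (p. 3: the set of minimal data "is compact, modulo
  the action of the scalings and translations") and proved on p. 8 ("`v₀^k → v₀` strongly", with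
  `v₀ ∈ M`): the normalised sequence stays in `M` (`NS.IsMinimalBlowupDatum.rescaleData_translate`)
  and every subsequence has a further subsequence converging in `Ḣ^{1/2}` to an element of `M`.
* `NS.rusin_sverak_weak_limit_blowup_iff_unit_viscosity`: the fact itself is equivalent to its
  unit-viscosity instance (the paper's normalisation `ν = 1`), by the viscosity scaling of
  `KatoViscosityScaling.lean`.

So both Rusin–Šverák facts of the tree rest on the one leaf `NS.rusin_sverak_weak_limit_blowup`
at `ν = 1`.

## References

* W. Rusin, V. Šverák, *Minimal initial data for potential Navier–Stokes singularities*,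
  J. Funct. Anal. 260 (2011) 879–891 = arXiv:0911.0500, §1 (p. 3), Cor. 4.2, Cor. 4.3 and its
  proof (p. 8).
* I. Gallagher, G. S. Koch, F. Planchon, Math. Ann. 355 (2013) = arXiv:1012.0145, §4,
  Statement 4.1 and Thm. 9 (second printed source: existence and compactness up to symmetries
  of minimal blow-up data in `Ḣ^{1/2}`).
-/

noncomputable section

open MeasureTheory TopologicalSpace Filter Topology Set Function
open scoped ENNReal InnerProductSpace

namespace Literature.Analysis.FluidPDE

/-! ## Weak lower semicontinuity of the norm -/

/-- **Weak lower semicontinuity of the Hilbert norm** (with an asymptotic bound): if `x n → a`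
weakly (`⟪x n, w⟫ → ⟪a, w⟫` for all `w`) and `‖x n‖ ≤ b n` with `b n → R`, then `‖a‖ ≤ R`, since
`‖a‖² = lim Re ⟪x n, a⟫ ≤ lim inf ‖x n‖ ‖a‖`. [folklore] -/
theorem norm_le_of_tendsto_inner_of_norm_le {H : Type*} [NormedAddCommGroup H]
    [InnerProductSpace ℂ H] {x : ℕ → H} {a : H}
    (hw : ∀ w : H, Tendsto (fun n => ⟪x n, w⟫_ℂ) atTop (𝓝 ⟪a, w⟫_ℂ)) {R : ℝ} {b : ℕ → ℝ}
    (hb : Tendsto b atTop (𝓝 R)) (hx : ∀ n, ‖x n‖ ≤ b n) : ‖a‖ ≤ R := by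
  have hre : Tendsto (fun n => RCLike.re ⟪x n, a⟫_ℂ) atTop (𝓝 (‖a‖ ^ 2)) := by
    have h1 : Tendsto (fun n => RCLike.re ⟪x n, a⟫_ℂ) atTop (𝓝 (RCLike.re ⟪a, a⟫_ℂ)) :=
      (RCLike.continuous_re.tendsto _).comp (hw a)
    have h2 : RCLike.re ⟪a, a⟫_ℂ = ‖a‖ ^ 2 := by
      rw [inner_self_eq_norm_sq_to_K]; norm_cast
    rwa [h2] at h1
  have hle : ∀ n, RCLike.re ⟪x n, a⟫_ℂ ≤ b n * ‖a‖ := fun n =>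
    (RCLike.re_le_norm _).trans ((norm_inner_le_norm _ _).trans
      (mul_le_mul_of_nonneg_right (hx n) (norm_nonneg a)))
  have h2 : ‖a‖ ^ 2 ≤ R * ‖a‖ := le_of_tendsto_of_tendsto' hre (hb.mul_const ‖a‖) hle
  rcases (norm_nonneg a).eq_or_lt with h0 | hpos
  · rw [← h0]
    exact ge_of_tendsto' hb fun n => (norm_nonneg _).trans (hx n)
  · exact le_of_mul_le_mul_right (by nlinarith [h2]) hpos

section NS

/-! ## Near-minimal blow-up data exist (definition of `ρ_max` as a supremum) -/

/-- By the definition of `ρ_max^pure(ν)` as the supremum of the radii of balls of global data,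
above the threshold there are blow-up data of norm as close to it as desired: for every
`r > ρ_max^pure(ν)` there is a weakly divergence-free `L³` datum represented in `Ḣ^{1/2}` with
norm `< r` and no global Kato solution (Rusin–Šverák 2011, §1, definition of `ρ_max`; proof of
Cor. 4.3, p. 8: "a sequence of initial data with `T_max(u₀^k)` finite and
`‖u₀^k‖_{Ḣ^{1/2}} → ρ_max`"). [cite: RusinSverak2011, proof of Cor. 4.3 (arXiv:0911.0500 p. 8)] -/
theorem exists_blowup_datum_enorm_lt {ν : ℝ} {r : ℝ≥0∞} (hr : rusinSverakRhoMaxPure ν < r) :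
    ∃ (u₀ : EuclideanSpace ℝ (Fin 3) → EuclideanSpace ℝ (Fin 3))
      (g : FunctionSpaces.HomSobolev (EuclideanSpace ℝ (Fin 3)) (EuclideanSpace ℂ (Fin 3)) (1 / 2 : ℝ)),
      MemLp u₀ 3 ∧ g.Represents (FunctionSpaces.EuclideanSpace.complexify ∘ u₀) ∧ FluidPDE.IsWeaklyDivFree u₀ ∧
        ‖g‖ₑ < r ∧ ¬ HasGlobalKatoSolution ν u₀ := by
  by_contra hcon
  push Not at hcon
  have hmem : r ∈ {ρ : ℝ≥0∞ | ∀ (u₀ : EuclideanSpace ℝ (Fin 3) → EuclideanSpace ℝ (Fin 3))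
      (g : FunctionSpaces.HomSobolev (EuclideanSpace ℝ (Fin 3)) (EuclideanSpace ℂ (Fin 3)) (1 / 2 : ℝ)),
      MemLp u₀ 3 → g.Represents (FunctionSpaces.EuclideanSpace.complexify ∘ u₀) → FluidPDE.IsWeaklyDivFree u₀ →
      ‖g‖ₑ < ρ → HasGlobalKatoSolution ν u₀} :=
    fun u₀ g hu₀ hg hdiv hlt => hcon u₀ g hu₀ hg hdiv hlt
  exact absurd hr (not_lt.2 (le_sSup hmem))

/-! ## Cor. 4.3, first clause: `M ≠ ∅` from the weak-limit blow-up fact -/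

/-- **Rusin–Šverák, Cor. 4.3, first clause ("the set `M` is non-empty") from its PDE input**:
the weak-limit blow-up fact `rusin_sverak_weak_limit_blowup` implies the tree's named fact
`rusin_sverak_minimal_blowup` (`MildSolutions.lean`, **ns.S14**: if `ρ_max^pure(ν) < ∞` there
is a minimal blow-up datum of norm exactly `ρ_max^pure(ν)`). Proof as printed
(arXiv:0911.0500 p. 8): blow-up data `u₀^k` with `ρ_max ≤ ‖u₀^k‖ < ρ_max + 1/(k+1)`
(`exists_blowup_datum_enorm_lt`); normalise by the fact's scales and centres (classes of the
same norm, `exists_represents_rescaleData_norm_eq`); extract a weakly convergent subsequence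
(`exists_strictMono_tendsto_inner`); its limit represents a blow-up datum `v₀` (the fact), so
`‖v₀‖ ≥ ρ_max` (`hasGlobalKatoSolution_of_lt_rusinSverakRhoMaxPure`) and `‖v₀‖ ≤ ρ_max` (weak
lower semicontinuity, `norm_le_of_tendsto_inner_of_norm_le`).
[cite: RusinSverak2011, Cor. 4.3 (arXiv:0911.0500 p. 8)] -/
theorem rusin_sverak_minimal_blowup_of_weak_limit_blowup (hKS : rusin_sverak_weak_limit_blowup) :
    rusin_sverak_minimal_blowup := by
  intro ν hν hfin
  set ρ := rusinSverakRhoMaxPure ν with hρ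
  have hρtop : ρ ≠ ⊤ := hfin.ne
  have hseq : ∀ k : ℕ, ∃ (u₀ : EuclideanSpace ℝ (Fin 3) → EuclideanSpace ℝ (Fin 3))
      (g : FunctionSpaces.HomSobolev (EuclideanSpace ℝ (Fin 3)) (EuclideanSpace ℂ (Fin 3)) (1 / 2 : ℝ)),
      MemLp u₀ 3 ∧ g.Represents (FunctionSpaces.EuclideanSpace.complexify ∘ u₀) ∧ FluidPDE.IsWeaklyDivFree u₀ ∧
        ‖g‖ₑ < ρ + ENNReal.ofReal (1 / ((k : ℝ) + 1)) ∧ ¬ HasGlobalKatoSolution ν u₀ := fun k =>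
    exists_blowup_datum_enorm_lt
      (ENNReal.lt_add_right hρtop (ENNReal.ofReal_pos.2 (by positivity)).ne')
  choose u₀ g hu3 hrep hdiv hlt hblow using hseq
  have hnorm_le : ∀ k, ‖g k‖ ≤ ρ.toReal + 1 / ((k : ℝ) + 1) := by
    intro k
    have h1 := hlt k
    rw [← ofReal_norm, ← ENNReal.ofReal_toReal hρtop,
      ← ENNReal.ofReal_add ENNReal.toReal_nonneg (by positivity)] at h1
    exact ((ENNReal.ofReal_lt_ofReal_iff (by positivity)).1 h1).le
  have hbound : ∀ k, ‖g k‖ ≤ ρ.toReal + 1 := fun k =>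
    (hnorm_le k).trans (by
      have : 1 / ((k : ℝ) + 1) ≤ 1 := by
        rw [div_le_one (by positivity)]
        linarith [(Nat.cast_nonneg k : (0 : ℝ) ≤ k)]
      linarith)
  obtain ⟨lam, x₀, hlam, hlim⟩ :=
    hKS ν hν u₀ g (fun k => ⟨hu3 k, hrep k, hdiv k, hblow k⟩) ⟨ρ.toReal + 1, hbound⟩
  choose g' hg'rep hg'norm using
    fun k => exists_represents_rescaleData_norm_eq (u₀ k) (g k) (hlam k) (x₀ k) (hrep k)
  haveI : SecondCountableTopology
      (FunctionSpaces.HomSobolev (EuclideanSpace ℝ (Fin 3)) (EuclideanSpace ℂ (Fin 3)) (1 / 2 : ℝ)) :=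
    homSobolev_half_secondCountableTopology
  obtain ⟨glim, φ, hφ, -, hweak⟩ :=
    exists_strictMono_tendsto_inner g' (R := ρ.toReal + 1) fun n => by
      rw [hg'norm]; exact hbound n
  obtain ⟨v₀, hv3, hvrep, hvdiv, hvblow⟩ := hlim g' hg'rep φ hφ glim hweak
  refine ⟨v₀, glim, hv3, hvrep, hvdiv, ?_, hvblow⟩
  have hge : ρ ≤ ‖glim‖ₑ := by
    by_contra h
    push Not at h
    exact hvblow (hasGlobalKatoSolution_of_lt_rusinSverakRhoMaxPure hv3 hvrep hvdiv h)
  have hle : ‖glim‖ ≤ ρ.toReal := by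
    refine norm_le_of_tendsto_inner_of_norm_le hweak
      (b := fun n => ρ.toReal + 1 / (((φ n : ℕ) : ℝ) + 1)) ?_
      (fun n => by rw [hg'norm]; exact hnorm_le (φ n))
    have h0 : Tendsto (fun n : ℕ => 1 / ((n : ℝ) + 1)) atTop (𝓝 0) :=
      tendsto_one_div_add_atTop_nhds_zero_nat
    simpa using (h0.comp hφ.tendsto_atTop).const_add ρ.toReal
  refine le_antisymm ?_ hge
  rw [← ofReal_norm, ← ENNReal.ofReal_toReal hρtop]
  exact ENNReal.ofReal_le_ofReal hle

/-! ## Cor. 4.3, second clause in the strong form: limit points in `M` -/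

/-- **Compactness of `M` modulo symmetries, strong form** (Rusin–Šverák 2011, §1 p. 3: the set
of `Ḣ^{1/2}`-minimal singularity-generating data "is compact, modulo the action of the
scalings and translations"; proof of Cor. 4.3, p. 8: "`‖v₀^k‖ → ‖v₀‖` and hence `v₀^k → v₀`
strongly", with `v₀ ∈ M`), from the weak-limit blow-up fact: for every sequence
`(u₀^k, g_k)` in `M` there are scales `λ_k > 0`, centres `x₀^k` and classes `g'_k` of the
normalised data `λ_k u₀^k(λ_k · - x₀^k)` such that the normalised data are again in `M`
(`IsMinimalBlowupDatum.rescaleData_translate`) and every subsequence `(g'_{σ(n)})` has a further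
subsequence converging in `Ḣ^{1/2}` to a class `g_∞` representing a minimal blow-up datum
`(v₀, g_∞) ∈ M`. Strengthens `rusin_sverak_minimal_data_compact_of_weak_limit_blowup` (which
only records `IsCompact (closure (range g'))`).
[cite: RusinSverak2011, Cor. 4.3 (arXiv:0911.0500 p. 8) with §1 (p. 3)] -/
theorem rusin_sverak_minimal_data_subseq_limit_of_weak_limit_blowup
    (hKS : rusin_sverak_weak_limit_blowup) {ν : ℝ} (hν : 0 < ν)
    (u₀ : ℕ → EuclideanSpace ℝ (Fin 3) → EuclideanSpace ℝ (Fin 3))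
    (g : ℕ → FunctionSpaces.HomSobolev (EuclideanSpace ℝ (Fin 3)) (EuclideanSpace ℂ (Fin 3)) (1 / 2 : ℝ))
    (hM : ∀ k, IsMinimalBlowupDatum ν (u₀ k) (g k)) :
    ∃ (lam : ℕ → ℝ) (x₀ : ℕ → EuclideanSpace ℝ (Fin 3))
      (g' : ℕ → FunctionSpaces.HomSobolev (EuclideanSpace ℝ (Fin 3)) (EuclideanSpace ℂ (Fin 3)) (1 / 2 : ℝ)),
      (∀ k, 0 < lam k) ∧
      (∀ k, IsMinimalBlowupDatum ν (FluidPDE.rescaleData (lam k) fun x => u₀ k (x - x₀ k)) (g' k)) ∧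
      ∀ σ : ℕ → ℕ, StrictMono σ →
        ∃ (φ : ℕ → ℕ) (v₀ : EuclideanSpace ℝ (Fin 3) → EuclideanSpace ℝ (Fin 3))
          (glim : FunctionSpaces.HomSobolev (EuclideanSpace ℝ (Fin 3)) (EuclideanSpace ℂ (Fin 3)) (1 / 2 : ℝ)),
          StrictMono φ ∧ IsMinimalBlowupDatum ν v₀ glim ∧
            Tendsto (fun n => g' (σ (φ n))) atTop (𝓝 glim) := by
  have hdata : ∀ k, MemLp (u₀ k) 3 ∧ (g k).Represents (FunctionSpaces.EuclideanSpace.complexify ∘ u₀ k) ∧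
      FluidPDE.IsWeaklyDivFree (u₀ k) ∧ ¬ HasGlobalKatoSolution ν (u₀ k) := fun k =>
    ⟨(hM k).1, (hM k).2.1, (hM k).2.2.1, (hM k).2.2.2.2⟩
  set ρ := rusinSverakRhoMaxPure ν with hρ
  have hρtop : ρ ≠ ⊤ := by
    have hk : ‖g 0‖ₑ = ρ := (hM 0).2.2.2.1
    rw [← hk]
    exact enorm_ne_top
  have hnorm : ∀ k, ‖g k‖ = ρ.toReal := fun k => by
    have hk : ‖g k‖ₑ = ρ := (hM k).2.2.2.1
    rw [← hk, toReal_enorm]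
  obtain ⟨lam, x₀, hlam, hlim⟩ := hKS ν hν u₀ g hdata ⟨ρ.toReal, fun k => (hnorm k).le⟩
  choose g' hg'rep hg'norm using
    fun k => exists_represents_rescaleData_norm_eq (u₀ k) (g k) (hlam k) (x₀ k) (hM k).2.1
  refine ⟨lam, x₀, g', hlam,
    fun k => (hM k).rescaleData_translate (hlam k) (x₀ k) (hg'rep k) (hg'norm k), fun σ hσ => ?_⟩
  haveI : SecondCountableTopology
      (FunctionSpaces.HomSobolev (EuclideanSpace ℝ (Fin 3)) (EuclideanSpace ℂ (Fin 3)) (1 / 2 : ℝ)) :=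
    homSobolev_half_secondCountableTopology
  have hb : ∀ n, ‖g' (σ n)‖ ≤ ρ.toReal := fun n => by rw [hg'norm, hnorm]
  obtain ⟨glim, φ, hφ, hle, hweak⟩ := exists_strictMono_tendsto_inner (fun n => g' (σ n)) hb
  obtain ⟨v₀, hv3, hvrep, hvdiv, hvblow⟩ := hlim g' hg'rep (σ ∘ φ) (hσ.comp hφ) glim hweak
  have hge : ρ ≤ ‖glim‖ₑ := by
    by_contra hlt
    push Not at hlt
    exact hvblow (hasGlobalKatoSolution_of_lt_rusinSverakRhoMaxPure hv3 hvrep hvdiv hlt)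
  have hnormlim : ‖glim‖ = ρ.toReal := by
    refine le_antisymm hle ?_
    have := ENNReal.toReal_mono (enorm_ne_top (x := glim)) hge
    rwa [toReal_enorm] at this
  have henorm : ‖glim‖ₑ = ρ := by
    rw [← ofReal_norm, hnormlim, ENNReal.ofReal_toReal hρtop]
  exact ⟨φ, v₀, glim, hφ, ⟨hv3, hvrep, hvdiv, henorm, hvblow⟩,
    tendsto_of_tendsto_inner_of_norm_eq hweak (fun n => by rw [hnormlim, hg'norm, hnorm])⟩

/-! ## The weak-limit blow-up fact is equivalent to its unit-viscosity instance -/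

/-- **`rusin_sverak_weak_limit_blowup` is equivalent to its instance `ν = 1`** (the paper's
normalisation, Rusin–Šverák 2011, §1 p. 3): scale the data by `ν⁻¹`
(`hasGlobalKatoSolution_smul_iff`, `represents_complexify_smul`), use the unit-viscosity
statement with the same scales and centres (the symmetries `u₀ ↦ λ u₀(λ · - x₀)` commute with
`u₀ ↦ ν⁻¹ u₀`), and scale weak limits and the limiting datum back by `ν` (weak convergence is
preserved by scalars).
[cite: RusinSverak2011, proof of Cor. 4.3 (arXiv:0911.0500 p. 8) with §1 (p. 3)] -/
theorem rusin_sverak_weak_limit_blowup_iff_unit_viscosity :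
    rusin_sverak_weak_limit_blowup ↔
      ∀ (u₀ : ℕ → EuclideanSpace ℝ (Fin 3) → EuclideanSpace ℝ (Fin 3))
        (g : ℕ → FunctionSpaces.HomSobolev (EuclideanSpace ℝ (Fin 3)) (EuclideanSpace ℂ (Fin 3)) (1 / 2 : ℝ)),
        (∀ k, MemLp (u₀ k) 3 ∧ (g k).Represents (FunctionSpaces.EuclideanSpace.complexify ∘ u₀ k) ∧
          FluidPDE.IsWeaklyDivFree (u₀ k) ∧ ¬ HasGlobalKatoSolution 1 (u₀ k)) →
        (∃ R : ℝ, ∀ k, ‖g k‖ ≤ R) →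
        ∃ (lam : ℕ → ℝ) (x₀ : ℕ → EuclideanSpace ℝ (Fin 3)), (∀ k, 0 < lam k) ∧
          ∀ g' : ℕ → FunctionSpaces.HomSobolev (EuclideanSpace ℝ (Fin 3)) (EuclideanSpace ℂ (Fin 3)) (1 / 2 : ℝ),
            (∀ k, (g' k).Represents (FunctionSpaces.EuclideanSpace.complexify ∘
              FluidPDE.rescaleData (lam k) (fun x => u₀ k (x - x₀ k)))) →
            ∀ φ : ℕ → ℕ, StrictMono φ →
              ∀ glim : FunctionSpaces.HomSobolev (EuclideanSpace ℝ (Fin 3)) (EuclideanSpace ℂ (Fin 3)) (1 / 2 : ℝ),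
              (∀ w, Tendsto (fun n => ⟪g' (φ n), w⟫_ℂ) atTop (𝓝 ⟪glim, w⟫_ℂ)) →
              ∃ v₀ : EuclideanSpace ℝ (Fin 3) → EuclideanSpace ℝ (Fin 3), MemLp v₀ 3 ∧
                glim.Represents (FunctionSpaces.EuclideanSpace.complexify ∘ v₀) ∧
                FluidPDE.IsWeaklyDivFree v₀ ∧ ¬ HasGlobalKatoSolution 1 v₀ := by
  refine ⟨fun h => h 1 one_pos, fun h1 => ?_⟩
  intro ν hν u₀ g hdata hR
  have hν' : (ν : ℂ) ≠ 0 := by exact_mod_cast hν.ne'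
  -- scale the data to unit viscosity
  have hK : ∀ {v₀ : EuclideanSpace ℝ (Fin 3) → EuclideanSpace ℝ (Fin 3)},
      HasGlobalKatoSolution 1 (ν⁻¹ • v₀) ↔ HasGlobalKatoSolution ν v₀ := fun {v₀} => by
    have h := hasGlobalKatoSolution_smul_iff (ν := ν) (u₀ := v₀) (inv_pos.2 hν)
    rwa [inv_mul_cancel₀ hν.ne'] at h
  have hdata1 : ∀ k, MemLp (ν⁻¹ • u₀ k) 3 ∧
      (((ν⁻¹ : ℝ) : ℂ) • g k).Represents (FunctionSpaces.EuclideanSpace.complexify ∘ (ν⁻¹ • u₀ k)) ∧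
      FluidPDE.IsWeaklyDivFree (ν⁻¹ • u₀ k) ∧ ¬ HasGlobalKatoSolution 1 (ν⁻¹ • u₀ k) := fun k =>
    ⟨(hdata k).1.const_smul _, represents_complexify_smul (hdata k).2.1 ν⁻¹,
      (hdata k).2.2.1.const_smul ν⁻¹, fun hK1 => (hdata k).2.2.2 (hK.1 hK1)⟩
  obtain ⟨R, hR⟩ := hR
  have hR1 : ∀ k, ‖((ν⁻¹ : ℝ) : ℂ) • g k‖ ≤ ν⁻¹ * R := fun k => by
    rw [norm_smul, Complex.norm_real, Real.norm_of_nonneg (inv_pos.2 hν).le]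
    exact mul_le_mul_of_nonneg_left (hR k) (inv_pos.2 hν).le
  obtain ⟨lam, x₀, hlam, hlim⟩ := h1 (fun k => ν⁻¹ • u₀ k) (fun k => ((ν⁻¹ : ℝ) : ℂ) • g k)
    hdata1 ⟨ν⁻¹ * R, hR1⟩
  refine ⟨lam, x₀, hlam, fun g' hg' φ hφ glim hweak => ?_⟩
  -- the scaled classes of the modulated data, their weak limit
  have hresc : ∀ k, FluidPDE.rescaleData (lam k) (fun x => (ν⁻¹ • u₀ k) (x - x₀ k)) =
      ν⁻¹ • FluidPDE.rescaleData (lam k) (fun x => u₀ k (x - x₀ k)) := fun k => by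
    funext x
    simp only [FluidPDE.rescaleData, Pi.smul_apply, smul_smul, mul_comm (lam k) ν⁻¹]
  have hg'1 : ∀ k, (((ν⁻¹ : ℝ) : ℂ) • g' k).Represents (FunctionSpaces.EuclideanSpace.complexify ∘
      FluidPDE.rescaleData (lam k) (fun x => (ν⁻¹ • u₀ k) (x - x₀ k))) := fun k => by
    rw [hresc]
    exact represents_complexify_smul (hg' k) ν⁻¹
  have hweak1 : ∀ w, Tendsto (fun n => ⟪((ν⁻¹ : ℝ) : ℂ) • g' (φ n), w⟫_ℂ) atTop
      (𝓝 ⟪((ν⁻¹ : ℝ) : ℂ) • glim, w⟫_ℂ) := fun w => by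
    simp only [inner_smul_left]
    exact (hweak w).const_mul _
  obtain ⟨v₁, hv3, hvrep, hvdiv, hvblow⟩ :=
    hlim (fun k => ((ν⁻¹ : ℝ) : ℂ) • g' k) hg'1 φ hφ (((ν⁻¹ : ℝ) : ℂ) • glim) hweak1
  -- scale the limiting datum back
  refine ⟨ν • v₁, hv3.const_smul _, ?_, hvdiv.const_smul ν, fun hKν => hvblow ?_⟩
  · have h2 := represents_complexify_smul hvrep ν
    rwa [smul_smul, ← Complex.ofReal_mul, mul_inv_cancel₀ hν.ne', Complex.ofReal_one,
      one_smul] at h2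
  · have h3 := hKν.timeRescale (inv_pos.2 hν)
    rwa [inv_mul_cancel₀ hν.ne', inv_smul_smul₀ hν.ne'] at h3

end NS

end Literature.Analysis.FluidPDE
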